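import Summits.AnomalousDissipation.AnomalousDissipation.Theses.BaireTransfer
import Literature.Analysis.FluidPDE.LinearizedNSTorus
import Literature.Analysis.FluidPDE.LongTimeAveragePeriodic
import Literature.Analysis.FunctionSpaces.TorusClassicalNSUniqueness
import Literature.Analysis.FunctionSpaces.TorusSpaceTime
import Literature.Analysis.FunctionSpaces.TorusFourierCalculus
import HarnessLib.Audit

/-!
# Line `drift-wave-symmetry-upgrade` — skeleton for crux `BaireTransfer.RobustLoudUpgrade`
(item stmt-AnomalousDissipation-1144, route route-AnomalousDissipation-BaireTransfer)

Crux (fixed, `crux_iff` below is `Iff.rfl`): `∃ S₀ ∀ S ⊇ S₀ ∀ E ε, 0 < ε → ∀ j,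
LOUD_j(S,E,ε) ⊆ closure (interior LOUD_j(S,2E,ε/2))`, where `LOUD^{(0,a)}(S,E,ε) ∋ c` iff the
steady trigonometric-polynomial force `f_c` carries, at SOME `ν ∈ (0,a)`, a time-periodic classical
NS solution with mean energy `≤ E` and mean dissipation `≥ ε`.

Idea (crux idea card `Ideas/drift-wave-symmetry-upgrade.md`, ideator 1; triage r1-1/2/3: pass,
merge-class with `malkin-cone-group-orbits` and `isotropy-tori-tongue-dichotomy` case (a)).
The crux's own why-might-fail names SYMMETRY TORI first: for a force `f_c` with a continuous
translation symmetry `x ↦ x + t·a` (`a ∈ ℤ³`, i.e. `a` orthogonal to every active frequency) every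
loud state breaking the symmetry is DEGENERATE (Goldstone mode `∂_a u ∈ ker L`), so the planner's
step (i) (IFT at a nondegenerate orbit) never fires there and step (ii) (Sard–Smale inside a FIXED
finite family) is the open Kupka–Smale question.  The lever: replace nondegeneracy by NORMAL
HYPERBOLICITY of the group orbit.  The translation circle `M₀ ≅ S¹` of a loud steady state of an
`a`-invariant force persists under EVERY small change of `c ∈ P_S` as an invariant `C¹` circle of
the (compact, analytic) NS semiflow at the same `ν > 0` (BatesLuZeng1998; Henry1981 Ch. 9;
Krupa1990 / LauterbachRoberts1992 / ChossatLauterbach2000 = forced symmetry breaking of group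
orbits), and a `C¹` vector field on a circle either vanishes somewhere (steady witnesses of the
perturbed force) or nowhere (the circle IS one periodic orbit: a slow DRIFT WAVE — time-periodic
because the one-parameter subgroup generated by a LATTICE vector is closed in `T³`,
`shift_add_one`); both are admissible witnesses whose period-means are weighted averages over
points `H¹`-close to translates of `u₀`: `c ∈ interior LOUD`, with NO stock (`S₀ = ∅`) and no
transversality (`stub_driftPersistence`, class **D**).  Symmetry is a resource, not an obstruction.

## Architecture: three robust witness classes + two approximation statements

Every loud witness is to be approximated, inside `P_S × (0,a)` (the free `ν`-slot of `LOUD` is part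
of the unfolding family) and with ARBITRARILY SMALL budget loss, by witnesses of one of three
spectrally defined ROBUST classes, each of which is force-open by a persistence theorem:

* **N** (`robustN`, `stub_nondegeneratePersistence`): the periodic witness is NONDEGENERATE IN ITS
  MEAN SLICE — multiplier `1` of the linearised period map is algebraically simple modulo the flow
  direction (`IsNondegenerateOrbit`, stated classically through smooth mean-zero periodic solutions
  of the linearised equation with a period-drift parameter `κ`; for steady witnesses: no Floquet
  exponent in `2πiℤ/τ`) ⇒ `interior LOUD` (Poincaré-map IFT, Henry1981 Ch. 8; Iooss1972).
* **D** (`robustD`, `stub_driftPersistence`, THE LEVER): normally hyperbolic translation circle of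
  loud steady states of an `a`-invariant force (`IsNHCircle`: `0` algebraically simple and no other
  neutral eigenvalue, in the tree's MEAN-ZERO spectral vocabulary `Torus.linNSAlgMultiplicity`,
  `Torus.IsLinNSEigenvalue` — triage X2/F1: Galilean boosts live outside the slice) ⇒ `interior LOUD`.
* **T** (`robustT`, `stub_torusLocking`): a loud periodic witness breaking `a` and normally
  hyperbolic MODULO time-phase and `a`-phase (`IsNHModShift`, Floquet–Bloch form): its group orbit
  is an invariant 2-torus foliated by periodic orbits (return map = identity), it persists, and the
  symmetry-BREAKING modes of the stock `S₀ = {|k|∞ ≤ 1}` lock it (first-order Malkin/Melnikov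
  function of a breaking mode is a zero-mean harmonic ⇒ strict sign change ⇒ an OPEN cone of forces
  with periodic orbits near the torus) ⇒ `closure (interior LOUD)` (card's L3; triage r1-2 (c)).

The two approximation stubs are split by whether the handed witness BREAKS a continuous symmetry of
its own force (`SymBreaking`):

* `stub_symmetricApproximation` (equivariant census): a symmetry-breaking loud witness is a limit of
  **N ∪ D ∪ T** witnesses of nearby forces — relative equilibria are N (travelling waves: time-phase =
  group phase) or D (steady circles) as soon as they are hyperbolic modulo isotropy; relative periodic
  orbits are T; `T²`-isotropy (shear/Kolmogorov-type forces) is broken in two steps; degenerate-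
  modulo-isotropy witnesses unfold along the Grashof ray / `P_S`.  Residual: SYMMETRIC GHOSTS.
* `stub_noLoudGhost` (the common residual of all eight round-1 ideas, Disproof §6(vi) "all-directions
  isola centre", here in its weakest useful form): a loud witness NOT breaking any continuous symmetry
  is a limit of robust witnesses of nearby `(c', ν')`.  HARDEST; the socket where lines
  `analytic-rank-dichotomy` / `trace-free-strain-robust-crossing` plug in.

Glue (sorry-free): `crux_iff`, the lattice-subgroup lemmas `shift_zero/shift_add/shift_add_one`,
`robustN_subset_loud`, `robustD_subset_loud`, `robustT_subset_loud` (the classes ARE loud witnesses,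
sharp budgets), `meanEnergy_pos_of_meanDissipation_pos` (positive dissipation ⇒ positive energy: the
place where the crux's load-bearing `0 < ε` is USED), `robust_subset_closure_interior`, and the
composition `RobustLoudUpgrade_of : RobustLoudUpgrade` (stock `S₀ := S₀ᵀ ∪ S₀ˢʸᵐ ∪ S₀ᵍʰ`; the
factor-2 relaxation is spent exactly once, to open the window `(energy, 2E) × (ε/2, dissipation)`).

## Disproof.lean obligations honoured (cdisprove gen 1–3; tree file `Cruxes/RobustLoudUpgrade/Disproof.lean`)

* `crux_false_without_pos_budget` (`0 < ε` load-bearing): USED, in `meanEnergy_pos_of_meanDissipation_pos`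
  → `RobustLoudUpgrade_of` (`E > 0` is what makes `2E` a genuine relaxation; at `E = ε = 0` the
  composition has no window and indeed `LOUD(S,0,0) ⊆ ker (c ↦ f_c)`).
* `not_isOpen_loud` / `cLam_not_mem_interior_loud` (sharp-budget `LOUD` is NOT open at the laminar
  ray): respected — every `interior` claim here is for witnesses with STRICT budget slack
  (`meanEnergy u < E`, `ε < meanDissipation ν u` in `robustN/D/T`); the laminar `cLam A` with its
  sharp budgets `(Elam, εlam)` is in no robust class at those budgets, only at relaxed ones.
* VERDICT (K-window) "UpgradeAtLaminar = weakest instance any proof must deliver": delivered by the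
  chain `stub_noLoudGhost` (the laminar state is `T²`-INVARIANT, hence not `SymBreaking`) →
  `stub_nondegeneratePersistence`, using the free `ν`-slot: `sh(A/4π²ν')` is a witness of the same
  `c` at every `ν'`, nondegenerate off a discrete set of `ν'`.
* §6(iii) (gen 2) planar families / Galilean boosts: all spectral notions are IN-SLICE (mean-zero
  perturbations), so `IsNHCircle` and `IsNondegenerateOrbit` are satisfiable (triage X2, F1); boosts
  are never used as perturbations of `c`.
* §6(vi)/§8 (gen 2) all-directions isola centre, `toy_upgrade_fails`: this is exactly the content
  of `stub_noLoudGhost` (and the symmetric-ghost residual of `stub_symmetricApproximation`); the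
  skeleton does not pretend the abstract continuation skeleton proves it.
* level is decoration (`robustLoudUpgrade_iff_levelZero`, gen 2): all stubs are stated for an
  arbitrary ceiling `a`, the composition specialises `a := 1/(j+1)`.
* `mem_loud_iff_extend` caveat (interiors do not zero-extend): no stub argues in `P_{S₀}` and
  extends; `S₀` only guarantees breaking/unfolding modes INSIDE the given `P_S`.
* Landed `Theorems/RobustLoudUpgrade/Negative/*`: none exist (2026-08-16); nothing to import.
-/

set_option linter.dupNamespace false

noncomputable section

open scoped BigOperators Topology
open Filter Set Function TopologicalSpace MeasureTheory

namespace Summit.AnomalousDissipation.AnomalousDissipation.Cruxes.RobustLoudUpgrade.DriftWaveSymmetryUpgrade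

open Literature.Analysis.FunctionSpaces Literature.Analysis.FunctionSpaces.Torus
open Literature.Analysis.FluidPDE
open Summit.AnomalousDissipation.AnomalousDissipation.Theses.BaireTransfer

/-- The flat unit torus `T³`. -/
local notation "𝕋³" => UnitAddTorus (Fin 3)
/-- Real velocity values. -/
local notation "ℝ³" => EuclideanSpace ℝ (Fin 3)
/-- Complex Fourier coefficients / complexified velocities. -/
local notation "ℂ³" => EuclideanSpace ℂ (Fin 3)

/-! ## §0 The crux's vocabulary (verbatim `Cruxes/RobustLoudUpgrade/Disproof.lean` §1) -/

/-- The parameter space `P_S = (↥S → ℂ³)` of coefficient vectors. [folklore] -/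
abbrev Coeff (S : Finset (Fin 3 → ℤ)) : Type := ↥S → ℂ³

/-- The steady trigonometric-polynomial force `f_c = realTrigPoly S (k ↦ P_k ĉ_k)` of the route
file (verbatim). [folklore] -/
@[folklore] def force (S : Finset (Fin 3 → ℤ)) (c : Coeff S) : 𝕋³ → ℝ³ :=
  realTrigPoly S (fun k => Torus.lerayCoeff k (coeffExt S c k))

/-- `LOUD^{(0,a)}(S,E,ε)` (the route's `LOUD_j` is `a = 1/(j+1)`), verbatim. [folklore] -/
@[folklore] def loud (S : Finset (Fin 3 → ℤ)) (a E ε : ℝ) : Set (Coeff S) :=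
  {c | ∃ ν : ℝ, 0 < ν ∧ ν < a ∧ ∃ (τ : ℝ) (u : ℝ → 𝕋³ → ℝ³) (p : ℝ → 𝕋³ → ℝ), 0 < τ ∧
    IsClassicalNSSolutionOn Set.univ ν (fun _ => force S c) u p ∧ Function.Periodic u τ ∧
      meanEnergy u ≤ E ∧ ε ≤ meanDissipation ν u}

/-- The viscosity ceiling of level `j`. [folklore] -/
abbrev ceil (j : ℕ) : ℝ := 1 / ((j : ℝ) + 1)

/-- **The crux, restated** (definitional; same as `Disproof.crux_iff`). [folklore] -/
theorem crux_iff :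
    RobustLoudUpgrade ↔
      ∃ S₀ : Finset (Fin 3 → ℤ), ∀ S : Finset (Fin 3 → ℤ), S₀ ⊆ S → ∀ (E ε : ℝ), 0 < ε →
        ∀ j : ℕ, loud S (ceil j) E ε ⊆ closure (interior (loud S (ceil j) (2 * E) (ε / 2))) :=
  Iff.rfl

/-! ## §1 Lattice one-parameter symmetries -/

/-- The one-parameter translation subgroup of `T³` generated by the lattice vector `a ∈ ℤ³`:
`shift a t = [t·a]`.  Because `a` is a LATTICE vector it is CLOSED (`shift_add_one`): drift along
it is periodic, never quasi-periodic — the card's "rational circles". [folklore] -/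
@[folklore] def shift (a : Fin 3 → ℤ) (t : ℝ) : 𝕋³ := Torus.proj (t • Torus.latticeVec a)

/-- The Goldstone generator `∂_a v (x) = d/ds|₀ v (x + [s·a])` (torus directional derivative
along `a`). [folklore] -/
@[folklore] def shiftDeriv (a : Fin 3 → ℤ) (v : 𝕋³ → ℝ³) (x : 𝕋³) : ℝ³ :=
  Torus.lineDeriv v x (Torus.latticeVec a)

/-- `f_c` is invariant under the whole one-parameter group generated by `a` (intrinsic form; it
holds as soon as `k ⬝ a = 0` for every ACTIVE frequency `k` of `c`, by `e_k(x + [t a]) =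
e^{2πi t k⬝a} e_k(x)`). [folklore] -/
@[folklore] def IsShiftInvariant (S : Finset (Fin 3 → ℤ)) (c : Coeff S) (a : Fin 3 → ℤ) : Prop :=
  ∀ (t : ℝ) (x : 𝕋³), force S c (x + shift a t) = force S c x

/-- The space–time field `u` is moved by some element of the one-parameter group of `a`. [folklore] -/
@[folklore] def BreaksShift (a : Fin 3 → ℤ) (u : ℝ → 𝕋³ → ℝ³) : Prop :=
  ∃ (s t : ℝ) (x : 𝕋³), u s (x + shift a t) ≠ u s x

/-- **The witness `u` breaks a continuous symmetry of its force**: some lattice direction `a ≠ 0`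
generates a symmetry group of `f_c` that moves `u`.  Equivalently (closed rational one-parameter
subgroups are dense in every subtorus): `u` is not fixed by the identity component of the isotropy
group of `f_c` in `T³`. [folklore] -/
@[folklore] def SymBreaking (S : Finset (Fin 3 → ℤ)) (c : Coeff S) (u : ℝ → 𝕋³ → ℝ³) : Prop :=
  ∃ a : Fin 3 → ℤ, a ≠ 0 ∧ IsShiftInvariant S c a ∧ BreaksShift a u

/-- `shift a 0 = 0`. [folklore] -/
@[simp] theorem shift_zero (a : Fin 3 → ℤ) : shift a 0 = 0 := by
  simp [shift, Torus.proj_zero]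

/-- `t ↦ shift a t` is a one-parameter subgroup. [folklore] -/
theorem shift_add (a : Fin 3 → ℤ) (s t : ℝ) : shift a (s + t) = shift a s + shift a t := by
  simp [shift, add_smul, Torus.proj_add]

/-- **The subgroup is closed (a circle)**: `shift a (t + 1) = shift a t`, since `[a] = 0` in `T³`
for a lattice vector.  This is why drift along a one-dimensional lattice symmetry is time-PERIODIC.
[folklore] -/
theorem shift_add_one (a : Fin 3 → ℤ) (t : ℝ) : shift a (t + 1) = shift a t := by
  rw [shift_add]
  simp [shift, Torus.proj_latticeVec]

/-- `shift a` is continuous. [folklore] -/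
theorem continuous_shift (a : Fin 3 → ℤ) : Continuous (shift a) :=
  Torus.continuous_proj.comp (continuous_id.smul continuous_const)

/-! ## §2 The linearised equation around a witness and the three robust classes -/

/-- **The linearised Navier–Stokes equation around the space–time field `u`** (real form, with an
inhomogeneity `g`): `z, q` jointly smooth on `ℝ × T³`, `z(t)` divergence free and MEAN ZERO
(in-slice linearisation: the mean of the velocity is conserved because `f_c` is mean zero, and all
persistence arguments run inside the affine slice `{∫u = ∫u(0)}` — triage X2/F1), and
`∂ₜz + (u·∇)z + (z·∇)u = νΔz − ∇q + g` pointwise. [cite: Henry1981, Ch. 8] -/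
@[folklore] def LinNSAround (ν : ℝ) (u z : ℝ → 𝕋³ → ℝ³) (q : ℝ → 𝕋³ → ℝ)
    (g : ℝ → 𝕋³ → ℝ³) : Prop :=
  IsSmoothSpaceTimeOn Set.univ z ∧ IsSmoothSpaceTimeOn Set.univ q ∧
    (∀ t, IsDivFree (z t)) ∧ (∀ t, HasZeroMean (z t)) ∧
    ∀ t x, Torus.timeDerivWithin Set.univ z t x + convect (u t) (z t) x + convect (z t) (u t) x =
      ν • laplacian (z t) x - Torus.gradient (q t) x + g t x

/-- The complexified homogeneous linearised equation around `u` (for Floquet–Bloch solutions with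
unimodular multipliers `ρ ≠ 1`): `∂ₜz + DB(u(t)) z = νΔz − ∇q` with the tree's
`Torus.linConvect (u t) (z t) = (u·∇)z + (z·∇)u`, `z(t)` complex, divergence free, mean zero.
[cite: Henry1981, Ch. 8] -/
@[folklore] def LinNSAroundC (ν : ℝ) (u : ℝ → 𝕋³ → ℝ³) (z : ℝ → 𝕋³ → ℂ³)
    (q : ℝ → 𝕋³ → ℂ) : Prop :=
  IsSmoothSpaceTimeOn Set.univ z ∧ IsSmoothSpaceTimeOn Set.univ q ∧
    (∀ t, Torus.IsDivFreeC (z t)) ∧ (∀ t, HasZeroMean (z t)) ∧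
    ∀ t x, Torus.timeDerivWithin Set.univ z t x + Torus.linConvect (u t) (z t) x =
      ν • laplacian (z t) x - Torus.gradientC (q t) x

/-- The flow direction `∂ₜu` (a solution of the homogeneous linearised equation for every classical
solution of the steadily forced system). [folklore] -/
@[folklore] def flowDir (u : ℝ → 𝕋³ → ℝ³) : ℝ → 𝕋³ → ℝ³ :=
  fun t x => Torus.timeDerivWithin Set.univ u t x

/-- The Goldstone direction `∂_a u` (a solution of the homogeneous linearised equation whenever the
force is `a`-invariant). [folklore] -/
@[folklore] def goldDir (a : Fin 3 → ℤ) (u : ℝ → 𝕋³ → ℝ³) : ℝ → 𝕋³ → ℝ³ :=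
  fun t x => shiftDeriv a (u t) x

/-- **In-slice nondegeneracy of a `τ`-periodic classical solution `u` of NS_ν** (multiplier `1` of
the monodromy `U(τ)` has algebraic multiplicity `dim ℝ∂ₜu ∈ {0,1}`): every smooth mean-zero
`τ`-periodic solution `z` of `∂ₜz + (u·∇)z + (z·∇)u = νΔz − ∇q + κ ∂ₜu` has `κ ∂ₜu ≡ 0` and
`z ∈ ℝ ∂ₜu`.  (Second periodic solutions = `ker (U(τ) − 1) ⊋ ℝu'`; solutions with `κ ≠ 0` = Jordan
partners `(U(τ) − 1)v = −κτ u'(0)`.  For a STEADY `u` (`∂ₜu = 0`) it reads: no non-zero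
`τ`-periodic solution of the autonomous linearised equation, i.e. no eigenvalue of `L(ν,u)` in
`2πiℤ/τ` — choose `τ` off resonance.) [cite: Henry1981, Ch. 8] -/
@[folklore] def IsNondegenerateOrbit (ν : ℝ) (u : ℝ → 𝕋³ → ℝ³) (τ : ℝ) : Prop :=
  ∀ (z : ℝ → 𝕋³ → ℝ³) (q : ℝ → 𝕋³ → ℝ) (κ : ℝ),
    LinNSAround ν u z q (fun t x => κ • flowDir u t x) → Function.Periodic z τ →
      (∀ t x, κ • flowDir u t x = 0) ∧ ∃ l : ℝ, ∀ t x, z t x = l • flowDir u t x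

/-- **Normal hyperbolicity of a `τ`-periodic witness modulo time-phase and `a`-phase**
(Floquet–Bloch form): (a) for every unimodular multiplier `ρ ≠ 1` the complex linearised equation
has no non-zero Bloch solution `z(t+τ) = ρ z(t)`; (b) at `ρ = 1`, every smooth mean-zero
`τ`-periodic solution of `∂ₜz + (u·∇)z + (z·∇)u = νΔz − ∇q + κ₁∂ₜu + κ₂∂_a u` has
`κ₁∂ₜu + κ₂∂_a u ≡ 0` and `z ∈ span_ℝ(∂ₜu, ∂_a u)` (no extra eigenvector, no Jordan partner).
For a steady `u` breaking `a` this is `IsNHCircle`; for a travelling wave along `a`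
(`∂ₜu ∥ ∂_a u`) it is hyperbolicity of the periodic orbit. [cite: ChossatLauterbach2000, Ch. 8–9] -/
@[folklore] def IsNHModShift (ν : ℝ) (u : ℝ → 𝕋³ → ℝ³) (τ : ℝ) (a : Fin 3 → ℤ) : Prop :=
  (∀ (z : ℝ → 𝕋³ → ℂ³) (q : ℝ → 𝕋³ → ℂ) (ρ : ℂ), ‖ρ‖ = 1 → ρ ≠ 1 →
      LinNSAroundC ν u z q → (∀ t x, z (t + τ) x = ρ • z t x) → ∀ t x, z t x = 0) ∧
  (∀ (z : ℝ → 𝕋³ → ℝ³) (q : ℝ → 𝕋³ → ℝ) (κ₁ κ₂ : ℝ),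
      LinNSAround ν u z q (fun t x => κ₁ • flowDir u t x + κ₂ • goldDir a u t x) →
      Function.Periodic z τ →
        (∀ t x, κ₁ • flowDir u t x + κ₂ • goldDir a u t x = 0) ∧
          ∃ l₁ l₂ : ℝ, ∀ t x, z t x = l₁ • flowDir u t x + l₂ • goldDir a u t x)

/-- **Normal hyperbolicity of the translation circle of a steady state `u₀`**, in the tree's
(mean-zero, classical point-spectrum) vocabulary of `LinearizedNSTorus`: `0` is an algebraically
simple eigenvalue of `L(ν,u₀)` (its eigenvector is then the Goldstone mode `∂_a u₀` as soon as
`u₀` breaks an `a`-symmetry of its force) and no other eigenvalue lies on `iℝ`.  Satisfiable: the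
Galilean boost `â ↦ −∂_a u₀` is NOT a Jordan partner here because `LinNSResolventRel` quantifies
over mean-zero fields (triage X2, F1). [cite: Krupa1990, normal hyperbolicity of group orbits of relative equilibria] -/
@[folklore] def IsNHCircle (ν : ℝ) (u₀ : 𝕋³ → ℝ³) : Prop :=
  Torus.linNSAlgMultiplicity ν u₀ 0 = 1 ∧
    ∀ μ : ℂ, Torus.IsLinNSEigenvalue ν u₀ μ → μ.re = 0 → μ = 0

/-- **Class N** — forces carrying, at some `ν ∈ (0,a)`, a `τ`-periodic classical witness with
STRICT budgets `meanEnergy < E`, `meanDissipation > ε` that is nondegenerate in its mean slice.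
[folklore] -/
@[folklore] def robustN (S : Finset (Fin 3 → ℤ)) (a E ε : ℝ) : Set (Coeff S) :=
  {c | ∃ ν : ℝ, 0 < ν ∧ ν < a ∧ ∃ (τ : ℝ) (u : ℝ → 𝕋³ → ℝ³) (p : ℝ → 𝕋³ → ℝ), 0 < τ ∧
    IsClassicalNSSolutionOn Set.univ ν (fun _ => force S c) u p ∧ Function.Periodic u τ ∧
      meanEnergy u < E ∧ ε < meanDissipation ν u ∧ IsNondegenerateOrbit ν u τ}

/-- **Class D (drift configurations — the lever's hypothesis set)** — forces carrying, at some
`ν ∈ (0,a)`, a STEADY classical witness `u₀` with strict budgets, a lattice direction `a ≠ 0`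
along which `f_c` is invariant but `u₀` is not, and a normally hyperbolic translation circle.
No stock, no transversality. [folklore] -/
@[folklore] def robustD (S : Finset (Fin 3 → ℤ)) (a E ε : ℝ) : Set (Coeff S) :=
  {c | ∃ ν : ℝ, 0 < ν ∧ ν < a ∧ ∃ (u₀ : 𝕋³ → ℝ³) (p₀ : 𝕋³ → ℝ),
    Torus.IsSteadyNSState ν (force S c) u₀ p₀ ∧
      meanEnergy (fun _ : ℝ => u₀) < E ∧ ε < meanDissipation ν (fun _ : ℝ => u₀) ∧
      ∃ a : Fin 3 → ℤ, a ≠ 0 ∧ IsShiftInvariant S c a ∧ BreaksShift a (fun _ : ℝ => u₀) ∧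
        IsNHCircle ν u₀}

/-- **Class T (tori)** — forces carrying, at some `ν ∈ (0,a)`, a `τ`-periodic classical witness with
strict budgets breaking a lattice symmetry `a ≠ 0` of `f_c` and normally hyperbolic modulo
time-phase and `a`-phase (its group orbit `{u(t)(· + [s a])}` is an invariant 2-torus foliated by
`τ`-periodic orbits, or a circle when `u` is a relative equilibrium). [folklore] -/
@[folklore] def robustT (S : Finset (Fin 3 → ℤ)) (a E ε : ℝ) : Set (Coeff S) :=
  {c | ∃ ν : ℝ, 0 < ν ∧ ν < a ∧ ∃ (τ : ℝ) (u : ℝ → 𝕋³ → ℝ³) (p : ℝ → 𝕋³ → ℝ), 0 < τ ∧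
    IsClassicalNSSolutionOn Set.univ ν (fun _ => force S c) u p ∧ Function.Periodic u τ ∧
      meanEnergy u < E ∧ ε < meanDissipation ν u ∧
      ∃ a : Fin 3 → ℤ, a ≠ 0 ∧ IsShiftInvariant S c a ∧ BreaksShift a u ∧ IsNHModShift ν u τ a}

/-- The union of the three robust classes. [folklore] -/
@[folklore] def robust (S : Finset (Fin 3 → ℤ)) (a E ε : ℝ) : Set (Coeff S) :=
  robustN S a E ε ∪ robustD S a E ε ∪ robustT S a E ε

/-- Class N consists of loud forces (strict budgets imply the weak ones). [folklore] -/
theorem robustN_subset_loud (S : Finset (Fin 3 → ℤ)) (a E ε : ℝ) : robustN S a E ε ⊆ loud S a E ε := by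
  rintro c ⟨ν, hν, hνa, τ, u, p, hτ, hsol, hper, hE, hε, -⟩
  exact ⟨ν, hν, hνa, τ, u, p, hτ, hsol, hper, hE.le, hε.le⟩

/-- Class D consists of loud forces: a steady state is `1`-periodic in time. [folklore] -/
theorem robustD_subset_loud (S : Finset (Fin 3 → ℤ)) (a E ε : ℝ) : robustD S a E ε ⊆ loud S a E ε := by
  rintro c ⟨ν, hν, hνa, u₀, p₀, hst, hE, hε, -⟩
  exact ⟨ν, hν, hνa, 1, fun _ => u₀, fun _ => p₀, one_pos, hst, fun _ => rfl, hE.le, hε.le⟩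

/-- Class T consists of loud forces. [folklore] -/
theorem robustT_subset_loud (S : Finset (Fin 3 → ℤ)) (a E ε : ℝ) : robustT S a E ε ⊆ loud S a E ε := by
  rintro c ⟨ν, hν, hνa, τ, u, p, hτ, hsol, hper, hE, hε, -⟩
  exact ⟨ν, hν, hνa, τ, u, p, hτ, hsol, hper, hE.le, hε.le⟩

/-- The robust classes are monotone in the budgets (used implicitly by provers of the approximation
stubs: a robust witness with budgets inside a window is robust for every larger window). [folklore] -/
theorem robust_mono (S : Finset (Fin 3 → ℤ)) (a : ℝ) {E E' ε ε' : ℝ} (hE : E ≤ E') (hε : ε' ≤ ε) :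
    robust S a E ε ⊆ robust S a E' ε' := by
  rintro c ((hN | hD) | hT)
  · obtain ⟨ν, hν, hνa, τ, u, p, hτ, hsol, hper, h1, h2, hnd⟩ := hN
    exact Or.inl (Or.inl ⟨ν, hν, hνa, τ, u, p, hτ, hsol, hper, h1.trans_le hE, hε.trans_lt h2, hnd⟩)
  · obtain ⟨ν, hν, hνa, u₀, p₀, hst, h1, h2, hrest⟩ := hD
    exact Or.inl (Or.inr ⟨ν, hν, hνa, u₀, p₀, hst, h1.trans_le hE, hε.trans_lt h2, hrest⟩)
  · obtain ⟨ν, hν, hνa, τ, u, p, hτ, hsol, hper, h1, h2, hrest⟩ := hT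
    exact Or.inr ⟨ν, hν, hνa, τ, u, p, hτ, hsol, hper, h1.trans_le hE, hε.trans_lt h2, hrest⟩

/-! ## §3 The five stubs of the line -/

/-- **Stub 1 — persistence of nondegenerate periodic witnesses (class N is force-open).**
If `f_c` carries at `ν ∈ (0,a)` a `τ`-periodic classical solution `u`, nondegenerate in its mean
slice, with `meanEnergy u < E` and `meanDissipation ν u > ε`, then `c ∈ interior LOUD^{(0,a)}(S,E,ε)`.
Why plausible: at fixed `ν > 0` the forced NS semiflow on `H^s_σ(T³) ∩ {∫u = m}` is analytic in
`(u, c)` with compact time-`τ` map (Henry1981 Ch. 3, 8; Iooss1972); `(v,T,c') ↦ Φ_{c'}(T,v) − v`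
has, at `(u(0), τ, c)`, derivative `(U(τ) − 1, ∂ₜu(0))`, surjective with kernel `ℝ(∂ₜu(0),0)` iff
`IsNondegenerateOrbit` (Fredholm index `0` of `U(τ) − 1`, `U(τ)` compact); IFT with a phase
condition gives periodic orbits of `f_{c'}` for all `c'` near `c`, `C⁰([0,2τ];H^s)`-close to `u`,
at the SAME `ν`; period means of `‖u‖₂²`, `ν‖∇u‖₂²` move continuously (`meanEnergy_eq_of_periodic`,
`meanDissipation_eq_of_periodic` = CesaroMeanPeriodic stmt-0514) and the strict slack absorbs it.
For steady `u` the same with the time-`τ` map alone.  Size L (needs the NS_ν semiflow on `T³` as a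
`C¹` map and the classical⇄mild dictionary for the linearised equation; none in tree).
Leans on: `IsClassicalNSSolutionOn`, `LongTimeAveragePeriodic`, `TorusClassicalNSUniqueness`
(energy methods), Mathlib `HasStrictFDerivAt.implicitFunction`. [cite: Henry1981, Ch. 8] -/
theorem stub_nondegeneratePersistence (S : Finset (Fin 3 → ℤ)) (a E ε : ℝ) :
    robustN S a E ε ⊆ interior (loud S a E ε) := by
  sorry

/-- **Stub 2 — THE LEVER: drift-wave persistence (class D is force-open, `S₀ = ∅`).**
If `f_c` is invariant under the lattice one-parameter group of `a ≠ 0` and carries at `ν ∈ (0,a)` a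
steady classical state `u₀` breaking it, with strict budgets and normally hyperbolic translation
circle `M₀ = {u₀(· + [t a])}` (in the mean slice), then `c ∈ interior LOUD^{(0,a)}(S,E,ε)`.
Why plausible: `M₀ ≅ S¹` is a compact normally hyperbolic manifold of equilibria of the analytic
compact semiflow `Φ_c` on the slice; it persists for every `c'` near `c` as an invariant `C¹`
circle `M_{c'}`, `C¹`-close to `M₀` (BatesLuZeng1998 persistence theorem; Henry1981 Ch. 9; finite-dim
template Fenichel1979; forced symmetry breaking of group orbits: Krupa1990, LauterbachRoberts1992,
ChossatLauterbach2000 Ch. 8–9); the induced `C¹` flow on a circle either has a rest point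
(a steady witness of `f_{c'}`, `1`-periodic) or none (then `M_{c'}` is ONE periodic orbit, the drift
wave; exactly time-periodic because the subgroup is closed, `shift_add_one`); every point of
`M_{c'}` is `H¹`-close to a translate of `u₀`, translations preserve `‖·‖₂`, `‖∇·‖₂`, so all period
means are within the strict slack; points of `M_{c'}` are smooth (full bounded orbits, parabolic
smoothing), so the witnesses are classical.  Size L (same infrastructure as Stub 1 + NHIM
persistence for a circle of equilibria, which can be done by parametrised centre-manifold reduction
along the compact circle + uniqueness of the maximal invariant set in a tube).
Leans on: `Torus.linNSAlgMultiplicity`, `Torus.IsLinNSEigenvalue`, `LinNSResolventRel`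
(LinearizedNSTorus), `shift_add_one`, `meanEnergy_eq_of_periodic`; named facts to vendor
(UNPROVED in tree): NHIM persistence for semiflows (BatesLuZeng1998). [cite: BatesLuZeng1998, persistence theorem for compact normally hyperbolic invariant manifolds of semiflows] -/
theorem stub_driftPersistence (S : Finset (Fin 3 → ℤ)) (a E ε : ℝ) :
    robustD S a E ε ⊆ interior (loud S a E ε) := by
  sorry

/-- **Stub 3 — torus locking (class T sits in `closure (interior LOUD)` once the stock contains
symmetry breakers).**  There is a finite stock `S₀` (intended: `{k : |k|∞ ≤ 1}`, which contains a
mode `e_i` with `a_i ≠ 0`, i.e. breaking `a`, for EVERY `a ≠ 0`) such that for `S ⊇ S₀`: if `f_c`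
carries a `τ`-periodic witness `u` breaking a lattice symmetry `a` of `f_c`, normally hyperbolic
modulo time- and `a`-phase, with strict budgets, then `c ∈ closure (interior LOUD^{(0,a)}(S,E,ε))`.
Why plausible: the group orbit `M = {u(t)(· + [s a])}` is a normally hyperbolic invariant 2-torus
(circle if `u` is a relative equilibrium — then Stubs 1–2 apply) foliated by `τ`-periodic orbits,
so its return map on the section `{t = 0} ≅ S¹` is the IDENTITY (rotation number `0/1` — no
irrational rotation can occur for the handed witness, Disproof gen 2 §6(iii)(β)); `M` persists for
`c' = c + δd` (BatesLuZeng1998); for a symmetry-BREAKING direction `d` (a mode `k` with `k ⬝ a ≠ 0`)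
the return map is `s ↦ s + δ m_d(s) + O(δ²)` with the first-order Malkin–Melnikov function
`m_d(s) = ∮⟨ψ_s, f_d⟩` a ZERO-MEAN pure harmonic in `s` (translation by `s a` multiplies `f_d`'s
pairing by `e^{2πi (k⬝a) s}`), hence, when `m_d ≢ 0`, a STRICT sign change, which is open in
`(d', δ)` (joint continuity) ⇒ fixed points of the return map, i.e. `≈τ`-periodic orbits near `M`
with budgets within the slack, for an OPEN set of forces accumulating at `c` (the isotropy-tori
`tongue_dichotomy` branch 2 / trace-free `mem_closure_interior_of_robust_crossing` engine; no
nondegeneracy of the locked orbits is needed).  Why it might fail: FIRST-order invisibility is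
forced by parity for orbits with half-period isotropy (triage r1-2 (β): then order 2 decides), and
ALL-orders invisibility of every breaking mode of `S₀` ("rigid/parabolic tongues") is the honest
residual (isotropy-tori K1); symmetric directions `d` only rotate rigidly and never lock.
Size L–XL.  Leans on: Stubs 1–2's infrastructure, Mathlib `CircleDeg1Lift` (not needed at `0/1`),
`intermediate_value_Icc`; ChossatLauterbach2000 Ch. 8–9, Krupa1990. [cite: ChossatLauterbach2000, Ch. 9] -/
theorem stub_torusLocking :
    ∃ S₀ : Finset (Fin 3 → ℤ), ∀ S : Finset (Fin 3 → ℤ), S₀ ⊆ S → ∀ a E ε : ℝ,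
      robustT S a E ε ⊆ closure (interior (loud S a E ε)) := by
  sorry

/-- **Stub 4 — equivariant census: a SYMMETRY-BREAKING loud witness is a limit of robust ones.**
There is a finite stock `S₀` (intended `{|k|∞ ≤ 1}`) such that for `S ⊇ S₀`: if `f_c` carries at
`ν ∈ (0,a)` a `τ`-periodic classical witness `u` with positive dissipation that breaks a continuous
symmetry of `f_c` (`SymBreaking`), then for all `E' > meanEnergy u`, `ε' < meanDissipation ν u`,
`c ∈ closure (robust S a E' ε')` — robust witnesses of nearby forces, at nearby viscosities, with
arbitrarily small budget loss.  Census (isotropy `K⁰ =` circle along `a`): (i) `u` steady ⇒ circle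
of equilibria: NH ⇒ `c ∈ robustD` itself; normally non-hyperbolic (relative Hopf point) or
normally degenerate (fold of circles) ⇒ unfold along the Grashof ray `c' = (1+δ)c` / inside `P_S`
into NH circles; (ii) `u` a travelling wave along `a` (`∂ₜu ∥ ∂_a u`: time-phase = group phase) ⇒
generically nondegenerate as a periodic orbit ⇒ `robustN` itself, degenerate ones unfold along the ray;
(iii) `u` relative periodic (2-torus) hyperbolic modulo `K⁰ × S¹` ⇒ `robustT` itself, otherwise
unfold; `K⁰ = T²` (rank-one active lattice, Kolmogorov/shear-type forces): break one direction by a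
unit mode `e_i` preserving the other (exists: the plane `⊥ b` contains a lattice vector with a zero
coordinate) — the persisted NH torus carries a residual-`S¹`-equivariant slow flow whose invariant
circles (zeros of a zero-mean function) are relative equilibria of `f_{c'}`: travelling waves (N) or
steady circles (D); `K⁰ = T³` means `f_c = 0`, no dissipative witness.  Why it might fail: SYMMETRIC
GHOSTS — a loud symmetric witness degenerate modulo isotropy in a way no direction of `P_S × (0,a)`
unfolds (all-directions isola centre of circles/tori, Disproof §6(vi)); first-order-invisible
`T²`-breaking.  Size L–XL.  Leans on: the vocabulary above; Krupa1990 (drift/bifurcation of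
relative equilibria), ChossatLauterbach2000, Fiedler1988 (relative Hopf), VanVeenKidaKawahara2006 /
ChandlerKerswell2013 (relative equilibria and relative UPOs of symmetric box flows are the observed
loud states). [cite: Krupa1990, drift/bifurcation theorems for relative equilibria] -/
theorem stub_symmetricApproximation :
    ∃ S₀ : Finset (Fin 3 → ℤ), ∀ S : Finset (Fin 3 → ℤ), S₀ ⊆ S → ∀ (a : ℝ) (c : Coeff S)
      (ν τ : ℝ) (u : ℝ → 𝕋³ → ℝ³) (p : ℝ → 𝕋³ → ℝ),
      0 < ν → ν < a → 0 < τ → IsClassicalNSSolutionOn Set.univ ν (fun _ => force S c) u p →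
      Function.Periodic u τ → 0 < meanDissipation ν u → SymBreaking S c u →
      ∀ E' ε' : ℝ, meanEnergy u < E' → ε' < meanDissipation ν u →
        c ∈ closure (robust S a E' ε') := by
  sorry

/-- **Stub 5 — NO LOUD GHOSTS (hardest; the common residual of all round-1 ideas, Disproof §6(vi)).**
There is a finite stock `S₀` such that for `S ⊇ S₀`: if `f_c` carries at `ν ∈ (0,a)` a
`τ`-periodic classical witness `u` with positive dissipation that does NOT break any continuous
symmetry of `f_c` (generic forces have none; for symmetric forces these are the INVARIANT witnesses,
e.g. the laminar `cLam` of Disproof §6), then for all `E' > meanEnergy u`, `ε' < meanDissipation ν u`,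
`c ∈ closure (robust S a E' ε')`.  Why plausible: such a witness has no Goldstone multiplier; if it
is nondegenerate, `c ∈ robustN` outright (laminar states: `sh(A/4π²ν')` is a witness of the same
`c` at EVERY `ν'`, nondegenerate off a discrete set — the free `ν`-slot is the Grashof ray,
grashof-arc-exchange / Disproof `UpgradeAtLaminar`); a degenerate one is generically a fold /
period-doubling / Neimark–Sacker / pitchfork point of the solution variety over `P_S × (0,a)`, all of
which have nondegenerate orbits on a side accumulating at `(c,ν)`; by Lyapunov–Schmidt the ONLY
local obstruction is an ALL-DIRECTIONS ISOLA CENTRE with definite even-order threshold (odd-order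
couplings to `P_S ⊕ ℝ∂_ν` of the adjoint neutral mode vanish — Disproof §6(vi), triage (α)); the
stock `S₀` is load-bearing exactly here (visibility `⟨ψ, P e_k⟩ ≠ 0` of low modes; sub-lattice
character classes, trace-free-strain's first-order tests).  Why it might fail: NS might have loud
ghosts — Kupka–Smale for NS in the force is open (FoiasTemam1976 p. 26 needs `m ≥ m₁(k,ν)` modes),
and the abstract analytic skeleton alone cannot exclude them (Disproof §8 `toy_upgrade_fails`,
j005253).  Size XL.  Leans on: Stub 1's vocabulary; FoiasTemam1976/1977, SautTemam1980 (generic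
nondegeneracy of steady states, all of `H`), Bernard2024 (restricted perturbation classes),
Henry1981 Ch. 8. [cite: FoiasTemam1976, Thm. 1 and p. 26] -/
theorem stub_noLoudGhost :
    ∃ S₀ : Finset (Fin 3 → ℤ), ∀ S : Finset (Fin 3 → ℤ), S₀ ⊆ S → ∀ (a : ℝ) (c : Coeff S)
      (ν τ : ℝ) (u : ℝ → 𝕋³ → ℝ³) (p : ℝ → 𝕋³ → ℝ),
      0 < ν → ν < a → 0 < τ → IsClassicalNSSolutionOn Set.univ ν (fun _ => force S c) u p →
      Function.Periodic u τ → 0 < meanDissipation ν u → ¬ SymBreaking S c u →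
      ∀ E' ε' : ℝ, meanEnergy u < E' → ε' < meanDissipation ν u →
        c ∈ closure (robust S a E' ε') := by
  sorry

/-! ## §4 Glue (sorry-free) -/

/-- A time-periodic classical solution with mean energy `≤ 0` vanishes identically (verbatim
`Disproof.velocity_eq_zero_of_meanEnergy_nonpos`, cdisprove gen 3 §8: `t ↦ ∫‖u(t)‖²` is
continuous, nonnegative, periodic with period average `≤ 0`). [folklore] -/
theorem velocity_eq_zero_of_meanEnergy_nonpos {ν τ : ℝ} {f u : ℝ → 𝕋³ → ℝ³} {p : ℝ → 𝕋³ → ℝ}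
    (hsol : IsClassicalNSSolutionOn Set.univ ν f u p) (hτ : 0 < τ) (hper : Function.Periodic u τ)
    (hE : meanEnergy u ≤ 0) (t : ℝ) : u t = 0 := by
  set g : ℝ → ℝ := fun t => ∫ x, ‖u t x‖ ^ 2 with hg
  have hsm : Torus.IsSmoothSpaceTimeOn Set.univ (fun t x => ‖u t x‖ ^ 2) := by
    have := hsol.smooth_velocity
    unfold Torus.IsSmoothSpaceTimeOn at this ⊢
    exact this.norm_sq (𝕜 := ℝ)
  have hcont : Continuous g := by
    rw [← continuousOn_univ]
    exact hsm.continuousOn_integral convex_univ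
  have hg0 : ∀ s, 0 ≤ g s := fun s => integral_nonneg fun _ => sq_nonneg _
  have hgper : Function.Periodic g τ := fun s => by simp only [hg, hper s]
  have havg : τ⁻¹ * ∫ s in (0 : ℝ)..τ, g s ≤ 0 := by
    rw [← meanEnergy_eq_of_periodic hper hτ]; exact hE
  have hint : ∫ s in (0 : ℝ)..τ, g s ≤ 0 := by
    have := mul_nonpos_iff.1 havg
    rcases this with ⟨_, h2⟩ | ⟨h1, _⟩
    · exact h2
    · exact absurd h1 (not_le.2 (inv_pos.2 hτ))
  have hint0 : ∫ s in (0 : ℝ)..τ, g s = 0 :=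
    le_antisymm hint (intervalIntegral.integral_nonneg hτ.le fun s _ => hg0 s)
  have hzero : ∀ s ∈ Set.Icc (0 : ℝ) τ, g s = 0 := by
    by_contra hne
    push Not at hne
    obtain ⟨s, hs, hgs⟩ := hne
    have hpos : 0 < g s := lt_of_le_of_ne (hg0 s) (Ne.symm hgs)
    have hlt := intervalIntegral.integral_lt_integral_of_continuousOn_of_le_of_exists_lt hτ
      continuousOn_const hcont.continuousOn (fun x _ => hg0 x) ⟨s, hs, hpos⟩
    rw [intervalIntegral.integral_zero, hint0] at hlt
    exact lt_irrefl _ hlt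
  obtain ⟨y, hy, hty⟩ := hgper.exists_mem_Ico₀ hτ t
  have hgt : g t = 0 := by rw [hty]; exact hzero y (Set.Ico_subset_Icc_self hy)
  exact Torus.eq_zero_of_integral_norm_sq_nonpos (hsol.smooth_velocity.isSmooth_slice (Set.mem_univ t))
    hgt.le

/-- The spectral gradient norm of the zero field vanishes. [folklore] -/
theorem eGradNormSq_zero : eGradNormSq (0 : 𝕋³ → ℝ³) = 0 := by
  have h0 : IsSmooth (0 : 𝕋³ → ℝ³) := isSmooth_const (0 : ℝ³)
  rw [eGradNormSq_eq_ofReal_gradNormSq h0]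
  have : gradNormSq (0 : 𝕋³ → ℝ³) = 0 := by
    unfold gradNormSq
    have hpd : ∀ (i : Fin 3) (x : 𝕋³), Torus.partialDeriv i (0 : 𝕋³ → ℝ³) x = 0 := fun i x => by
      change deriv (fun _ : ℝ => (0 : ℝ³)) 0 = 0
      simp
    simp [hpd]
  rw [this, ENNReal.ofReal_zero]

/-- The zero flow dissipates nothing. [folklore] -/
theorem meanDissipation_zero (ν : ℝ) : meanDissipation ν (fun (_ : ℝ) => (0 : 𝕋³ → ℝ³)) = 0 := by
  rw [meanDissipation_eq_of_periodic (τ := 1) (fun _ => rfl) one_pos]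
  simp [eGradNormSq_zero]

/-- **Positive dissipation forces positive energy.**  This is where the crux's LOAD-BEARING
hypothesis `0 < ε` enters the line (Disproof `crux_false_without_pos_budget`): it makes
`meanEnergy u > 0`, hence `2E > E ≥ meanEnergy u` a genuine window. [folklore] -/
theorem meanEnergy_pos_of_meanDissipation_pos {ν τ : ℝ} {f u : ℝ → 𝕋³ → ℝ³} {p : ℝ → 𝕋³ → ℝ}
    (hsol : IsClassicalNSSolutionOn Set.univ ν f u p) (hτ : 0 < τ) (hper : Function.Periodic u τ)
    (hdiss : 0 < meanDissipation ν u) : 0 < meanEnergy u := by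
  by_contra hE
  push Not at hE
  have hu : ∀ t, u t = 0 := velocity_eq_zero_of_meanEnergy_nonpos hsol hτ hper hE
  have hu' : u = fun (_ : ℝ) => (0 : 𝕋³ → ℝ³) := funext hu
  rw [hu', meanDissipation_zero] at hdiss
  exact lt_irrefl _ hdiss

/-- The robust classes lie in `closure (interior LOUD)` with the SAME (sharp) budgets, for every
`S` containing the torus stock (Stubs 1, 2, 3). [folklore] -/
theorem robust_subset_closure_interior {S₀ S : Finset (Fin 3 → ℤ)}
    (hT : ∀ S : Finset (Fin 3 → ℤ), S₀ ⊆ S → ∀ a E ε : ℝ,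
      robustT S a E ε ⊆ closure (interior (loud S a E ε)))
    (hS : S₀ ⊆ S) (a E ε : ℝ) :
    robust S a E ε ⊆ closure (interior (loud S a E ε)) := by
  refine Set.union_subset (Set.union_subset ?_ ?_) (hT S hS a E ε)
  · exact (stub_nondegeneratePersistence S a E ε).trans subset_closure
  · exact (stub_driftPersistence S a E ε).trans subset_closure

/-- **Composition: the five stubs prove the crux `RobustLoudUpgrade` (by name).**
Stock `S₀ := S₀ᵀ ∪ S₀ˢʸᵐ ∪ S₀ᵍʰ`.  Given `c ∈ LOUD_j(S,E,ε)` with witness `(ν,τ,u,p)` and `0 < ε`: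
dissipation `≥ ε > 0` forces `meanEnergy u > 0` (`meanEnergy_pos_of_meanDissipation_pos`), so the
factor-2 budgets open the strict window `meanEnergy u < 2E`, `ε/2 < meanDissipation ν u`; by Stub 4
or Stub 5 (according to `SymBreaking`) `c ∈ closure (robust S (1/(j+1)) (2E) (ε/2))`; by Stubs 1–3
`robust ⊆ closure (interior LOUD_j(S,2E,ε/2))`; `closure` is idempotent. -/
theorem RobustLoudUpgrade_of : RobustLoudUpgrade := by
  obtain ⟨S₃, h₃⟩ := stub_torusLocking
  obtain ⟨S₄, h₄⟩ := stub_symmetricApproximation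
  obtain ⟨S₅, h₅⟩ := stub_noLoudGhost
  refine ⟨S₃ ∪ S₄ ∪ S₅, fun S hS E ε hε j c hc => ?_⟩
  have hS₃ : S₃ ⊆ S := (Finset.subset_union_left.trans Finset.subset_union_left).trans hS
  have hS₄ : S₄ ⊆ S := (Finset.subset_union_right.trans Finset.subset_union_left).trans hS
  have hS₅ : S₅ ⊆ S := Finset.subset_union_right.trans hS
  obtain ⟨ν, hν, hνa, τ, u, p, hτ, hsol, hper, hE, hεu⟩ := hc
  -- the load-bearing `0 < ε`: positive dissipation ⇒ positive energy ⇒ `2E` is a genuine relaxation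
  have hdiss : 0 < meanDissipation ν u := hε.trans_le hεu
  have hEpos : 0 < meanEnergy u := meanEnergy_pos_of_meanDissipation_pos hsol hτ hper hdiss
  have hE' : meanEnergy u < 2 * E := by linarith
  have hε' : ε / 2 < meanDissipation ν u := by linarith
  -- approximation by robust witnesses inside the window (Stub 4 on the symmetry-breaking stratum,
  -- Stub 5 off it)
  have key : c ∈ closure (robust S (ceil j) (2 * E) (ε / 2)) := by
    by_cases hsym : SymBreaking S c u
    · exact h₄ S hS₄ (ceil j) c ν τ u p hν hνa hτ hsol hper hdiss hsym (2 * E) (ε / 2) hE' hε'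
    · exact h₅ S hS₅ (ceil j) c ν τ u p hν hνa hτ hsol hper hdiss hsym (2 * E) (ε / 2) hE' hε'
  -- robust witnesses are (limits of) interior points of the relaxed loud set (Stubs 1, 2, 3)
  have hsub := robust_subset_closure_interior h₃ hS₃ (ceil j) (2 * E) (ε / 2)
  have hfin := closure_mono hsub key
  rw [closure_closure] at hfin
  exact hfin

end Summit.AnomalousDissipation.AnomalousDissipation.Cruxes.RobustLoudUpgrade.DriftWaveSymmetryUpgrade

end
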